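import Summits.QuantumFields.YangMills.Theorems.BalabanUVNodesN07ChartLinFlatBgReg
import HarnessLib

/-!
# N07 at the record — THE KNIT TOKEN (rng) AT A GENERAL CHART POINT OF THE FRAME-FREE (47)-CARRYING CHART: for every slice coordinate `A` with `Q A = 0`
# (not only the fixed point `𝒜♭(V)`), `𝔖♭.chartLin T♭ V A ∈ bgReg ∧ Ū^k(𝔖♭.chartLin T♭ V A) = V` in the small — the form a non-singleton family `Kc V ⊆ ker Q`
# of the K0ᴬ road consumes; at `N = 2` with the `SU`-exponent and trace rows replaced by the reality of `A + 𝔄♭V`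

Cell `pub-ymgap`, seat `pub-ymgap-dag-n07-w3` (g28, WIDTH SEAT 3 on N07 [B11]); helper file keyed `--supports stmt-QuantumFields-27238 --as helper` (K0ᴬ road);
count-neutral.  INTENT-21 of the seat: files 15–17 ∕ 20 treated the FIXED POINT (`Kc V := {𝒜♭(V)}`); the road's (rng) quantifies over `A ∈ Kc V` for a family
`Kc V ⊆ {A | Q A = 0, …}` (the linear slice (102) ∕ (109)), so here `A` is general with `Q A = 0` displayed.

## What is here (frame-free; slot `T♭ := fun _ => T47 (H1OfRecordAtBgFlat …) (CslOfRecord …) ε_C` inline)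

* §1 (any `N`) ★ `readFun_Q_add_frakA_of_eq_zero` (`Q A = 0 ⟹ Q(A + 𝔄♭V) = B(V)`: T-Q ✓`readFun_QOfRecord_jet_eq_qCplxOp` + (45) ✓`Q_H1OfRecordAtBg128`),
  ★ `iterMh_T47_eq_of_logDisc_at` (the frame-free bridge ⟸ + (48) at a GENERAL `A′` with `Q A′ = B(V)`: ✓`readFun_Q_T47_of_eq`, ✓`CslOfRecord_of_trace_eq_zero`,
  ✓`iterMh_eq_of_Q_add_C_eq_B`), ★★★ `iter_chartLinFlat_eq` (Sect. C `Regime`, `‖A + 𝔄♭V‖ < a_C`, `Q A = 0`, trace row, `SU`-exponent row, guard, two log-disc rows ⟹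
  `Averaging.iter (avOfRecord F N K) k (𝔖♭.chartLin T♭ V A) = V`), ★★★ `exists_radius_knitRng_chartLinFlat` (one `ρ`: guard + A-side row + class conjunct discharged for
  `‖A + 𝔄♭V‖ < ρ`, given `U₀ ∈ bgReg F N K k ε`: `chartLin ∈ bgReg ∧ Ū^k(chartLin) = V`).
* §2 (`N = 2`) ★★ `expoLinAtFlat_mem_of_realRows` (the `SU`-exponent row at a general chart point from the reality of `A + 𝔄♭V` — g26 ✓`conjJet_T47OfRecord_eq`, g27
  ✓`trace_equiv_T47OfRecord_eq_zero_two`), ★★★★ `exists_radius_knitRng_chartLinFlat_of_realRows_two` — (rng) IN FULL at a general slice coordinate: displayed = `U₀ ∈ bgReg`, guard,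
  Sect. C rows (`RC`, `Prop4Hyp`, `hCreal`, `hCtr`), `Q A = 0`, the reality of `A + 𝔄♭V` (Hermitian + traceless jet), `V ∈ logDiscOfRecord`, `‖A + 𝔄♭V‖ < ρ` — for ALL scheme parameters.

## Honest labels

Bookkeeping on landed letters; nothing of Bałaban's estimates; K0ᴬ ⟨27238⟩ NOT closed; N07 NOT discharged; R4 is the conditional finite-𝕋⁴ rung `BalabanLadder.UV` only; finite torus
at fixed `ε` — nothing continuum ∕ OS ∕ Clay.  **The Yang–Mills mass gap is NOT proved by any of this.**  No `sorry`, no `def`, no `instance ∕ notation`; standard axioms.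
[cite: Balaban1985Variational, (15) p.280, (20) p.281, (44)–(48) p.285, (51) p.286, (102)–(103) p.293, (109) p.294; Balaban1987RG1, (0.21) p.256, (1.2) p.260]
-/

set_option autoImplicit false

noncomputable section

open scoped Matrix Matrix.Norms.L2Operator InnerProductSpace Topology

namespace Summit.QuantumFields.YangMills.Theorems.N07ChartLinAverageFlatPoint

open Filter Metric
open Literature.MathematicalPhysics.QuantumFieldTheory.Balaban1983to89
open Literature.MathematicalPhysics.QuantumFieldTheory.Balaban1983to89.T4Continuum (T4Family)
open Literature.MathematicalPhysics.QuantumFieldTheory.Balaban1983to89.Node00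
open B15AveragingHolomorphic (iterMh)
open B9AdOrthogonal (herm0 mem_herm0)
open T4AdjointCovarianceUnitary (lieSU exp_mem_specialUnitaryGroup_of_mem_lieSU)
open B11Eq103H1Complex (SiteL2K BondL2K readFun)
open B11Eq111FrakG (nabla115)
open B11Eq115Space (NegSize NegSup JetSup)
open B11Eq174Chart (Regime)
open B11Prop6Scheme (Prop4Hyp)
open B11Eq90V0GroupComposed (T47)
open Summit.QuantumFields.YangMills.Theorems.N07ConstraintLogBridge (readFun_QOfRecord_jet_eq_qCplxOp iterMh_eq_of_Q_add_C_eq_B)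
open Summit.QuantumFields.YangMills.Theorems.N07Eq48AtRecord (readFun_Q_T47_of_eq)
open Summit.QuantumFields.YangMills.Theorems.N07T47ChartAverage (iter_eq_of_iterMh_eq)
open Summit.QuantumFields.YangMills.Theorems.N07ChartLinAverageFlat (coeField_chartLinFlat_eq_expOver exists_radius_rowsFlat)
open Summit.QuantumFields.YangMills.Theorems.N07ChartLinFlatBgReg (exists_radius_bgRegFlat)
open Summit.QuantumFields.YangMills.Theorems.N07EmapOfRecordRealSlice (conjJet_T47OfRecord_eq)
open Summit.QuantumFields.YangMills.Theorems.N07EmapOfRecordTraceSectors (trace_equiv_T47OfRecord_eq_zero_two)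

section Record

variable (F : T4Family) (N : ℕ) [NeZero N] (K : ℕ) (k : ℕ) (Ω : ℕ → Set (Site (F.P K) 0)) (U₀ : GaugeField (F.P K) 0 (SU N))
  [Fact (0 < (F.L : ℝ))] [Fact (0 < (F.P K).eta k)] [Fact (0 < c0Rec F K k)] [Fact (∀ c, 0 < wBRec F K k c)]
  (levB : PBond (F.P K) k → ℕ) (a : ℝ)
  (hposb : ∀ x, x ≠ 0 → 0 < RCLike.re ⟪x, laplaceAOfRecord F N k U₀ (QOfRecord F N k U₀) (QflatOfRecord F N k) a x⟫_ℂ)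
  (hQ : Function.Surjective (QOfRecord F N k U₀))
  (Gp : SiteL2K ℂ (F.P K).d (fun _ => (F.P K).sitesPerDir 0) (c0Rec F K k) (WRec N) →ₗ[ℂ]
    SiteL2K ℂ (F.P K).d (fun _ => (F.P K).sitesPerDir 0) (c0Rec F K k) (WRec N))
  (Δ2 : BondL2K ℂ (F.P K).d (fun _ => (F.P K).sitesPerDir 0) (c0Rec F K k) (WRec N) →ₗ[ℂ]
    BondL2K ℂ (F.P K).d (fun _ => (F.P K).sitesPerDir 0) (c0Rec F K k) (WRec N))
  (hposπ : ∀ x, x ≠ 0 → 0 < RCLike.re ⟪x, laplaceAOfRecordAt F N k U₀ (hessOpOfRecord128 F N k U₀ Gp (QflatOfRecord F N k) Δ2)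
    (QOfRecord F N k U₀) (QflatOfRecord F N k) a x⟫_ℂ)

/-! ## §1  Any `N`: the average conjunct and the class conjunct at a general slice coordinate -/

/-- ★ **THE LINEAR CONSTRAINT OF A SLICE COORDINATE**: `Q A = 0 ⟹ Q(A + 𝔄♭V) = B(V)` (T-Q linearity + (45) `Q H₁ = 1`, `𝔄♭ = H₁B`).
[cite: Balaban1985Variational, (20) p.281, (45) p.285, (103) p.293, (109) p.294] -/
theorem readFun_Q_add_frakA_of_eq_zero (V : GaugeField (F.P K) k (SU N)) {A : Space115Lit F N K k Ω U₀}
    (hQA : readFun (phiRec N) _ (wBRec F K k) (QOfRecord F N k U₀) (JetSup.equiv _ _ (nabla115 ((F.P K).eta k) (unitsOfRecord F N U₀)) A) = 0) :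
    readFun (phiRec N) _ (wBRec F K k) (QOfRecord F N k U₀)
        (JetSup.equiv _ _ (nabla115 ((F.P K).eta k) (unitsOfRecord F N U₀)) (A + frakAOfRecordAtBg128 F N K k Ω U₀ levB Gp Δ2 a hposπ hQ V)) =
      NegSup.equiv _ _ (BOfRecord F N K k U₀ levB V) := by
  rw [readFun_QOfRecord_jet_eq_qCplxOp, map_add, map_add, ← readFun_QOfRecord_jet_eq_qCplxOp, ← readFun_QOfRecord_jet_eq_qCplxOp, hQA, zero_add,
    frakAOfRecordAtBg128_eq]
  exact Q_H1OfRecordAtBg128 F N K k Ω U₀ levB Gp Δ2 a hposπ hQ (BOfRecord F N K k U₀ levB V)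

/-- ★ **THE FRAME-FREE BRIDGE AT A GENERAL `A′` WITH `Q A′ = B(V)`**: (48) + `C^{sl} = C` on traceless jets + the bridge ⟸ on the log-disc ⟹ `Ū^k_h(expOver U₀ (η•evLit (T47 A′))) = ↑V`.
[cite: Balaban1985Variational, (20) p.281, (44)–(48) p.285, (51) p.286] -/
theorem iterMh_T47_eq_of_logDisc_at {b C₂ c₄ aC εC : ℝ}
    (RC : Regime (H1OfRecordAtBgFlat F N K k Ω U₀ levB a hposb hQ) (0 : Space115Lit F N K k Ω U₀ →L[ℂ] Space115Lit F N K k Ω U₀)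
      (CslOfRecord F N K k Ω U₀ levB) b 0 C₂ c₄ 0 aC εC)
    {A' : Space115Lit F N K k Ω U₀} (hA' : ‖A'‖ < aC) {V : GaugeField (F.P K) k (SU N)}
    (hB : readFun (phiRec N) _ (wBRec F K k) (QOfRecord F N k U₀) (JetSup.equiv _ _ (nabla115 ((F.P K).eta k) (unitsOfRecord F N U₀)) A') =
      NegSup.equiv _ _ (BOfRecord F N K k U₀ levB V))
    (htr : ∀ b', (JetSup.equiv _ _ (nabla115 ((F.P K).eta k) (unitsOfRecord F N U₀))
        (T47 (H1OfRecordAtBgFlat F N K k Ω U₀ levB a hposb hQ) (CslOfRecord F N K k Ω U₀ levB) εC A') b').trace = 0)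
    (hdiscA : ∀ c, ‖iterMh k (expOver U₀ ((((F.P K).eta k : ℝ) : ℂ) • evLit F N K k Ω U₀
        (T47 (H1OfRecordAtBgFlat F N K k Ω U₀ levB a hposb hQ) (CslOfRecord F N K k Ω U₀ levB) εC A'))) c
        * star (Averaging.iter (avOfRecord F N K) k U₀ c : Matrix (Fin N) (Fin N) ℂ) - 1‖ < 1)
    (hdiscV : ∀ c, ‖(V c : Matrix (Fin N) (Fin N) ℂ) * star (Averaging.iter (avOfRecord F N K) k U₀ c : Matrix (Fin N) (Fin N) ℂ) - 1‖ < 1) :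
    iterMh k (expOver U₀ ((((F.P K).eta k : ℝ) : ℂ) • evLit F N K k Ω U₀
        (T47 (H1OfRecordAtBgFlat F N K k Ω U₀ levB a hposb hQ) (CslOfRecord F N K k Ω U₀ levB) εC A'))) = coeField V := by
  have h48 := readFun_Q_T47_of_eq F N K k Ω U₀ levB a hposb hQ RC hA' hB
  rw [CslOfRecord_of_trace_eq_zero F N K k Ω U₀ levB htr] at h48
  exact iterMh_eq_of_Q_add_C_eq_B F N K k Ω U₀ levB _ h48 hdiscA hdiscV

/-- ★★★ **(rng)'s AVERAGE CONJUNCT AT A GENERAL SLICE COORDINATE OF THE FRAME-FREE (47)-CARRYING CHART** (any `N`): `Ū^k(𝔖♭.chartLin T♭ V A) = V`.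
[cite: Balaban1985Variational, (15) p.280, (20) p.281, (44)–(48) p.285; Balaban1987RG1, (0.21) p.256] -/
theorem iter_chartLinFlat_eq (dom : Set (GaugeField (F.P K) k (SU N))) {εC B₀ C₄ a₃ j a𝔄 ε₄ b C₂ c₄ aC : ℝ}
    (RC : Regime (H1OfRecordAtBgFlat F N K k Ω U₀ levB a hposb hQ) (0 : Space115Lit F N K k Ω U₀ →L[ℂ] Space115Lit F N K k Ω U₀)
      (CslOfRecord F N K k Ω U₀ levB) b 0 C₂ c₄ 0 aC εC)
    {V : GaugeField (F.P K) k (SU N)} (hV : V ∈ logDiscOfRecord F N K k U₀) {A : Space115Lit F N K k Ω U₀}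
    (hA : ‖A + frakAOfRecordAtBg128 F N K k Ω U₀ levB Gp Δ2 a hposπ hQ V‖ < aC)
    (hQA : readFun (phiRec N) _ (wBRec F K k) (QOfRecord F N k U₀) (JetSup.equiv _ _ (nabla115 ((F.P K).eta k) (unitsOfRecord F N U₀)) A) = 0)
    (htr : ∀ b', (JetSup.equiv _ _ (nabla115 ((F.P K).eta k) (unitsOfRecord F N U₀))
        (T47 (H1OfRecordAtBgFlat F N K k Ω U₀ levB a hposb hQ) (CslOfRecord F N K k Ω U₀ levB) εC
          (A + frakAOfRecordAtBg128 F N K k Ω U₀ levB Gp Δ2 a hposπ hQ V)) b').trace = 0)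
    (hSU : ∀ b', (bgSchemeOfRecord F N K k Ω U₀ dom levB Gp Δ2 a hposπ hposb hQ εC B₀ C₄ a₃ j a𝔄 ε₄).expoLinAt
      (fun _ => T47 (H1OfRecordAtBgFlat F N K k Ω U₀ levB a hposb hQ) (CslOfRecord F N K k Ω U₀ levB) εC) V A b' ∈ Matrix.specialUnitaryGroup (Fin N) ℂ)
    (hguard : SmallBelow (avOfRecord F N K) k ((bgSchemeOfRecord F N K k Ω U₀ dom levB Gp Δ2 a hposπ hposb hQ εC B₀ C₄ a₃ j a𝔄 ε₄).chartLin
      (fun _ => T47 (H1OfRecordAtBgFlat F N K k Ω U₀ levB a hposb hQ) (CslOfRecord F N K k Ω U₀ levB) εC) V A))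
    (hdiscA : ∀ c, ‖iterMh k (expOver U₀ ((((F.P K).eta k : ℝ) : ℂ) • evLit F N K k Ω U₀
        (T47 (H1OfRecordAtBgFlat F N K k Ω U₀ levB a hposb hQ) (CslOfRecord F N K k Ω U₀ levB) εC
          (A + frakAOfRecordAtBg128 F N K k Ω U₀ levB Gp Δ2 a hposπ hQ V)))) c
        * star (Averaging.iter (avOfRecord F N K) k U₀ c : Matrix (Fin N) (Fin N) ℂ) - 1‖ < 1) :
    Averaging.iter (avOfRecord F N K) k ((bgSchemeOfRecord F N K k Ω U₀ dom levB Gp Δ2 a hposπ hposb hQ εC B₀ C₄ a₃ j a𝔄 ε₄).chartLin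
      (fun _ => T47 (H1OfRecordAtBgFlat F N K k Ω U₀ levB a hposb hQ) (CslOfRecord F N K k Ω U₀ levB) εC) V A) = V :=
  iter_eq_of_iterMh_eq F N K k (coeField_chartLinFlat_eq_expOver F N K k Ω U₀ levB a hposb hQ Gp Δ2 hposπ dom V A hSU) hguard
    (iterMh_T47_eq_of_logDisc_at F N K k Ω U₀ levB a hposb hQ RC hA (readFun_Q_add_frakA_of_eq_zero F N K k Ω U₀ levB a hQ Gp Δ2 hposπ V hQA) htr hdiscA
      ((mem_logDiscOfRecord_iff F N K k U₀ V).1 hV))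

/-- ★★★ **THE KNIT TOKEN (rng) AT A GENERAL SLICE COORDINATE, GUARD ∕ A-SIDE ROW ∕ CLASS CONJUNCT DISCHARGED IN THE SMALL** (any `N`): one `ρ > 0` (`ρ ≤ a_C`; background, Sect. C
data, `ε`) such that for ALL scheme parameters, every `V` in the log-disc and every `A` with `Q A = 0`, `‖A + 𝔄♭V‖ < ρ`, the trace row and the `SU`-exponent row:
`𝔖♭.chartLin T♭ V A ∈ bgReg F N K k ε ∧ Ū^k(𝔖♭.chartLin T♭ V A) = V`. [cite: Balaban1987RG1, (0.21) p.256, (1.2) p.260; Balaban1985Variational, (15) p.280, (20) p.281, (47) p.285] -/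
theorem exists_radius_knitRng_chartLinFlat (hU₀ : SmallBelow (avOfRecord F N K) k U₀) {ε : ℝ} (hU₀reg : U₀ ∈ bgReg F N K k ε) {b C₂ c₄ aC εC : ℝ}
    (RC : Regime (H1OfRecordAtBgFlat F N K k Ω U₀ levB a hposb hQ) (0 : Space115Lit F N K k Ω U₀ →L[ℂ] Space115Lit F N K k Ω U₀)
      (CslOfRecord F N K k Ω U₀ levB) b 0 C₂ c₄ 0 aC εC)
    (hC : Prop4Hyp (CslOfRecord F N K k Ω U₀ levB) C₂ c₄) (haC : 0 < aC) :
    ∃ ρ : ℝ, 0 < ρ ∧ ρ ≤ aC ∧ ∀ (dom : Set (GaugeField (F.P K) k (SU N))) (B₀ C₄ a₃ j a𝔄 ε₄ : ℝ) {V : GaugeField (F.P K) k (SU N)},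
      V ∈ logDiscOfRecord F N K k U₀ → ∀ {A : Space115Lit F N K k Ω U₀}, ‖A + frakAOfRecordAtBg128 F N K k Ω U₀ levB Gp Δ2 a hposπ hQ V‖ < ρ →
      readFun (phiRec N) _ (wBRec F K k) (QOfRecord F N k U₀) (JetSup.equiv _ _ (nabla115 ((F.P K).eta k) (unitsOfRecord F N U₀)) A) = 0 →
      (∀ b', (JetSup.equiv _ _ (nabla115 ((F.P K).eta k) (unitsOfRecord F N U₀))
        (T47 (H1OfRecordAtBgFlat F N K k Ω U₀ levB a hposb hQ) (CslOfRecord F N K k Ω U₀ levB) εC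
          (A + frakAOfRecordAtBg128 F N K k Ω U₀ levB Gp Δ2 a hposπ hQ V)) b').trace = 0) →
      (∀ b', (bgSchemeOfRecord F N K k Ω U₀ dom levB Gp Δ2 a hposπ hposb hQ εC B₀ C₄ a₃ j a𝔄 ε₄).expoLinAt
        (fun _ => T47 (H1OfRecordAtBgFlat F N K k Ω U₀ levB a hposb hQ) (CslOfRecord F N K k Ω U₀ levB) εC) V A b' ∈ Matrix.specialUnitaryGroup (Fin N) ℂ) →
      (bgSchemeOfRecord F N K k Ω U₀ dom levB Gp Δ2 a hposπ hposb hQ εC B₀ C₄ a₃ j a𝔄 ε₄).chartLin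
          (fun _ => T47 (H1OfRecordAtBgFlat F N K k Ω U₀ levB a hposb hQ) (CslOfRecord F N K k Ω U₀ levB) εC) V A ∈ bgReg F N K k ε ∧
        Averaging.iter (avOfRecord F N K) k ((bgSchemeOfRecord F N K k Ω U₀ dom levB Gp Δ2 a hposπ hposb hQ εC B₀ C₄ a₃ j a𝔄 ε₄).chartLin
          (fun _ => T47 (H1OfRecordAtBgFlat F N K k Ω U₀ levB a hposb hQ) (CslOfRecord F N K k Ω U₀ levB) εC) V A) = V := by
  obtain ⟨ρ₁, hρ₁, hρ₁aC, hrows⟩ := exists_radius_rowsFlat F N K k Ω U₀ levB a hposb hQ hU₀ RC hC haC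
  obtain ⟨ρ₂, hρ₂, -, hcls⟩ := exists_radius_bgRegFlat F N K k Ω U₀ levB a hposb hQ hU₀reg RC hC haC
  refine ⟨min ρ₁ ρ₂, lt_min hρ₁ hρ₂, (min_le_left _ _).trans hρ₁aC, fun dom B₀ C₄ a₃ j a𝔄 ε₄ V hV A hA hQA htr hSU => ?_⟩
  have hA₁ := lt_of_lt_of_le hA (min_le_left _ _)
  have hA₂ := lt_of_lt_of_le hA (min_le_right _ _)
  have hcoe := coeField_chartLinFlat_eq_expOver F N K k Ω U₀ levB a hposb hQ Gp Δ2 hposπ dom V A hSU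
  obtain ⟨hguard, hdiscA⟩ := hrows _ hA₁
  exact ⟨hcls _ hA₂ _ hcoe, iter_chartLinFlat_eq F N K k Ω U₀ levB a hposb hQ Gp Δ2 hposπ dom RC hV (lt_of_lt_of_le hA₁ hρ₁aC) hQA htr hSU
    (hguard _ hcoe) hdiscA⟩

end Record

/-! ## §2  `N = 2`: the `SU`-exponent and trace rows at a general chart point from the reality of `A + 𝔄♭V` -/

section Two

variable (F : T4Family) {K : ℕ} (k : ℕ) (Ω : ℕ → Set (Site (F.P K) 0)) (U₀ : GaugeField (F.P K) 0 (SU 2))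
  [Fact (0 < (F.L : ℝ))] [Fact (0 < (F.P K).eta k)] (levB : PBond (F.P K) k → ℕ) [Fact (0 < c0Rec F K k)] [Fact (∀ c, 0 < wBRec F K k c)] (a : ℝ)
  (hposb : ∀ x, x ≠ 0 → 0 < RCLike.re ⟪x, laplaceAOfRecord F 2 k U₀ (QOfRecord F 2 k U₀) (QflatOfRecord F 2 k) a x⟫_ℂ)
  (hQ : Function.Surjective (QOfRecord F 2 k U₀)) {b C₂ c₄ aC εC : ℝ}
  (RC : Regime (H1OfRecordAtBgFlat F 2 K k Ω U₀ levB a hposb hQ) 0 (CslOfRecord F 2 K k Ω U₀ levB) b 0 C₂ c₄ 0 aC εC)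
  (hCreal : ∀ A : Space115Lit F 2 K k Ω U₀,
    ((JetSup.equiv _ _ (nabla115 ((F.P K).eta k) (unitsOfRecord F 2 U₀))).symm
        (star (JetSup.equiv _ _ (nabla115 ((F.P K).eta k) (unitsOfRecord F 2 U₀)) A)) : Space115Lit F 2 K k Ω U₀) = A →
    ‖A‖ ≤ εC + aC → ((NegSup.equiv _ _).symm (star (NegSup.equiv _ _ (CslOfRecord F 2 K k Ω U₀ levB A))) :
      NegSize (F.L : ℝ) ((F.P K).eta k) levB 0 (Matrix (Fin 2) (Fin 2) ℂ)) = CslOfRecord F 2 K k Ω U₀ levB A)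
  (hCtr : ∀ A : Space115Lit F 2 K k Ω U₀,
    ((JetSup.equiv _ _ (nabla115 ((F.P K).eta k) (unitsOfRecord F 2 U₀))).symm
        (star (JetSup.equiv _ _ (nabla115 ((F.P K).eta k) (unitsOfRecord F 2 U₀)) A)) : Space115Lit F 2 K k Ω U₀) = A →
    (∀ b, (JetSup.equiv _ _ (nabla115 ((F.P K).eta k) (unitsOfRecord F 2 U₀)) A b).trace = 0) →
    ‖A‖ ≤ εC + aC → ∀ c, (NegSup.equiv _ _ (CslOfRecord F 2 K k Ω U₀ levB A) c).trace = 0)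
  (Gp : SiteL2K ℂ (F.P K).d (fun _ => (F.P K).sitesPerDir 0) (c0Rec F K k) (WRec 2) →ₗ[ℂ]
    SiteL2K ℂ (F.P K).d (fun _ => (F.P K).sitesPerDir 0) (c0Rec F K k) (WRec 2))
  (Δ2 : BondL2K ℂ (F.P K).d (fun _ => (F.P K).sitesPerDir 0) (c0Rec F K k) (WRec 2) →ₗ[ℂ]
    BondL2K ℂ (F.P K).d (fun _ => (F.P K).sitesPerDir 0) (c0Rec F K k) (WRec 2))
  (hposπ : ∀ x, x ≠ 0 → 0 < RCLike.re ⟪x, laplaceAOfRecordAt F 2 k U₀ (hessOpOfRecord128 F 2 k U₀ Gp (QflatOfRecord F 2 k) Δ2)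
    (QOfRecord F 2 k U₀) (QflatOfRecord F 2 k) a x⟫_ℂ)

include RC hCreal hCtr in
/-- ★★ **THE `SU`-EXPONENT ROW AT A GENERAL CHART POINT FROM THE REALITY OF `A + 𝔄♭V`** (`N = 2`): if `A + 𝔄♭V` is a Hermitian traceless jet with `‖A + 𝔄♭V‖ < a_C`, then
`exp(i·ev(T♭(A + 𝔄♭V))(b)) ∈ SU(2)` on every bond (g26 reality + g27 trace of `T47`, read at `bondToLit b`; `η` real). [cite: Balaban1985Variational, (15) p.280, (19) p.281, (47) p.285, (51) p.286] -/
theorem expoLinAtFlat_mem_of_realRows (h : SmallBelow (avOfRecord F 2 K) k U₀) (dom : Set (GaugeField (F.P K) k (SU 2))) (B₀ C₄ a₃ j a𝔄 ε₄ : ℝ)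
    (V : GaugeField (F.P K) k (SU 2)) {A : Space115Lit F 2 K k Ω U₀}
    (hherm : ((JetSup.equiv _ _ (nabla115 ((F.P K).eta k) (unitsOfRecord F 2 U₀))).symm
      (star (JetSup.equiv _ _ (nabla115 ((F.P K).eta k) (unitsOfRecord F 2 U₀)) (A + frakAOfRecordAtBg128 F 2 K k Ω U₀ levB Gp Δ2 a hposπ hQ V))) :
        Space115Lit F 2 K k Ω U₀) = A + frakAOfRecordAtBg128 F 2 K k Ω U₀ levB Gp Δ2 a hposπ hQ V)
    (htrA : ∀ b', (JetSup.equiv _ _ (nabla115 ((F.P K).eta k) (unitsOfRecord F 2 U₀)) (A + frakAOfRecordAtBg128 F 2 K k Ω U₀ levB Gp Δ2 a hposπ hQ V) b').trace = 0)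
    (hn : ‖A + frakAOfRecordAtBg128 F 2 K k Ω U₀ levB Gp Δ2 a hposπ hQ V‖ < aC) (bd : PBond (F.P K) 0) :
    (bgSchemeOfRecord F 2 K k Ω U₀ dom levB Gp Δ2 a hposπ hposb hQ εC B₀ C₄ a₃ j a𝔄 ε₄).expoLinAt
      (fun _ => T47 (H1OfRecordAtBgFlat F 2 K k Ω U₀ levB a hposb hQ) (CslOfRecord F 2 K k Ω U₀ levB) εC) V A bd ∈ Matrix.specialUnitaryGroup (Fin 2) ℂ := by
  set A' := A + frakAOfRecordAtBg128 F 2 K k Ω U₀ levB Gp Δ2 a hposπ hQ V with hA'def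
  set M : Matrix (Fin 2) (Fin 2) ℂ := JetSup.equiv _ _ (nabla115 ((F.P K).eta k) (unitsOfRecord F 2 U₀))
    (T47 (H1OfRecordAtBgFlat F 2 K k Ω U₀ levB a hposb hQ) (CslOfRecord F 2 K k Ω U₀ levB) εC A') (bondToLit (F.P K) 0 bd) with hMdef
  have hherm' : Mᴴ = M := by
    have e := congrArg (fun Y : Space115Lit F 2 K k Ω U₀ => JetSup.equiv _ _ (nabla115 ((F.P K).eta k) (unitsOfRecord F 2 U₀)) Y (bondToLit (F.P K) 0 bd))
      (conjJet_T47OfRecord_eq F 2 K k Ω U₀ levB hposb hQ RC hCreal h hherm hn)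
    simp only [Equiv.apply_symm_apply, Pi.star_apply, Matrix.star_eq_conjTranspose] at e
    rw [hMdef]
    exact e
  have htr' : M.trace = 0 := trace_equiv_T47OfRecord_eq_zero_two F k Ω U₀ levB hposb hQ RC hCreal hCtr h hherm htrA hn (bondToLit (F.P K) 0 bd)
  have hev : (bgSchemeOfRecord F 2 K k Ω U₀ dom levB Gp Δ2 a hposπ hposb hQ εC B₀ C₄ a₃ j a𝔄 ε₄).expoLinAt
      (fun _ => T47 (H1OfRecordAtBgFlat F 2 K k Ω U₀ levB a hposb hQ) (CslOfRecord F 2 K k Ω U₀ levB) εC) V A bd =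
        NormedSpace.exp (Complex.I • (((F.P K).eta k : ℂ) • M)) := rfl
  rw [hev]
  have hmem : ((F.P K).eta k : ℂ) • M ∈ herm0 (Fin 2) := by
    rw [mem_herm0]
    refine ⟨?_, ?_⟩
    · show (((F.P K).eta k : ℂ) • M)ᴴ = ((F.P K).eta k : ℂ) • M
      rw [Matrix.conjTranspose_smul, hherm', Complex.star_def, Complex.conj_ofReal]
    · rw [Matrix.trace_smul, htr', smul_zero]
  exact exp_mem_specialUnitaryGroup_of_mem_lieSU (BgScheme.I_smul_mem_lieSU_of_mem_herm0 hmem)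

include RC hCreal hCtr in
/-- ★★★★ **THE KNIT TOKEN (rng) IN FULL AT A GENERAL SLICE COORDINATE, `N = 2`, WITH THE `SU`-EXPONENT AND TRACE ROWS REPLACED BY THE REALITY OF `A + 𝔄♭V`**: one `ρ > 0`
(background in the class and guarded; Sect. C data; `ε`) such that for ALL scheme parameters, every `V ∈ logDiscOfRecord` and every `A` with `Q A = 0`, `‖A + 𝔄♭V‖ < ρ` and
`A + 𝔄♭V` a Hermitian traceless jet: `𝔖♭.chartLin T♭ V A ∈ bgReg F 2 K k ε ∧ Ū^k(𝔖♭.chartLin T♭ V A) = V`.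
[cite: Balaban1987RG1, (0.21) p.256, (1.2) p.260; Balaban1985Variational, (15) p.280, (20) p.281, (47) p.285, (51) p.286, (109) p.294] -/
theorem exists_radius_knitRng_chartLinFlat_of_realRows_two (h : SmallBelow (avOfRecord F 2 K) k U₀) {ε : ℝ} (hU₀reg : U₀ ∈ bgReg F 2 K k ε)
    (hC : Prop4Hyp (CslOfRecord F 2 K k Ω U₀ levB) C₂ c₄) (haC : 0 < aC) :
    ∃ ρ : ℝ, 0 < ρ ∧ ρ ≤ aC ∧ ∀ (dom : Set (GaugeField (F.P K) k (SU 2))) (B₀ C₄ a₃ j a𝔄 ε₄ : ℝ) {V : GaugeField (F.P K) k (SU 2)},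
      V ∈ logDiscOfRecord F 2 K k U₀ → ∀ {A : Space115Lit F 2 K k Ω U₀}, ‖A + frakAOfRecordAtBg128 F 2 K k Ω U₀ levB Gp Δ2 a hposπ hQ V‖ < ρ →
      readFun (phiRec 2) _ (wBRec F K k) (QOfRecord F 2 k U₀) (JetSup.equiv _ _ (nabla115 ((F.P K).eta k) (unitsOfRecord F 2 U₀)) A) = 0 →
      ((JetSup.equiv _ _ (nabla115 ((F.P K).eta k) (unitsOfRecord F 2 U₀))).symm
        (star (JetSup.equiv _ _ (nabla115 ((F.P K).eta k) (unitsOfRecord F 2 U₀)) (A + frakAOfRecordAtBg128 F 2 K k Ω U₀ levB Gp Δ2 a hposπ hQ V))) :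
          Space115Lit F 2 K k Ω U₀) = A + frakAOfRecordAtBg128 F 2 K k Ω U₀ levB Gp Δ2 a hposπ hQ V →
      (∀ b', (JetSup.equiv _ _ (nabla115 ((F.P K).eta k) (unitsOfRecord F 2 U₀)) (A + frakAOfRecordAtBg128 F 2 K k Ω U₀ levB Gp Δ2 a hposπ hQ V) b').trace = 0) →
      (bgSchemeOfRecord F 2 K k Ω U₀ dom levB Gp Δ2 a hposπ hposb hQ εC B₀ C₄ a₃ j a𝔄 ε₄).chartLin
          (fun _ => T47 (H1OfRecordAtBgFlat F 2 K k Ω U₀ levB a hposb hQ) (CslOfRecord F 2 K k Ω U₀ levB) εC) V A ∈ bgReg F 2 K k ε ∧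
        Averaging.iter (avOfRecord F 2 K) k ((bgSchemeOfRecord F 2 K k Ω U₀ dom levB Gp Δ2 a hposπ hposb hQ εC B₀ C₄ a₃ j a𝔄 ε₄).chartLin
          (fun _ => T47 (H1OfRecordAtBgFlat F 2 K k Ω U₀ levB a hposb hQ) (CslOfRecord F 2 K k Ω U₀ levB) εC) V A) = V := by
  obtain ⟨ρ, hρ, hρaC, hfin⟩ := exists_radius_knitRng_chartLinFlat F 2 K k Ω U₀ levB a hposb hQ Gp Δ2 hposπ h hU₀reg RC hC haC
  refine ⟨ρ, hρ, hρaC, fun dom B₀ C₄ a₃ j a𝔄 ε₄ V hV A hA hQA hherm htrA => ?_⟩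
  have hn := lt_of_lt_of_le hA hρaC
  exact hfin dom B₀ C₄ a₃ j a𝔄 ε₄ hV hA hQA
    (fun b' => trace_equiv_T47OfRecord_eq_zero_two F k Ω U₀ levB hposb hQ RC hCreal hCtr h hherm htrA hn b')
    (expoLinAtFlat_mem_of_realRows F k Ω U₀ levB a hposb hQ RC hCreal hCtr Gp Δ2 hposπ h dom B₀ C₄ a₃ j a𝔄 ε₄ V hherm htrA hn)

end Two

end Summit.QuantumFields.YangMills.Theorems.N07ChartLinAverageFlatPoint

end
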